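import Summits.AtomisticToContinuum.FouriersLaw.Theorems.BondHeatUncertaintyBoundedResponseTailSign
import Literature.Barriers.AtomisticToContinuum.LowTemperatureWeakAnharmonicity
import HarnessLib

/-!
(SPLIT FOR THE 400-LINE CAP by the landing lane, hand-2 g36: this file = part 1 of 2 (§1–§3); the sequel `…BondHeatUncertaintyBoundedResponseThermalScaling` (§4–§5) imports it; same namespace and section, all FQNs unchanged.)
# Bounded response — the exact THERMAL SCALING identity of the escape currency (cell `decomp-a2c`, lens-1, gen 98)

NORMAL-FORM RUNG beneath the shared waypoint `stmt-AtomisticToContinuum-11071`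
(`Theses.BondHeatUncertainty.BoundedResponse` ⟺ `EscapeGrading.OhmicFloor`), ruled as the g98 target by critic row 1382 (ii):
"the exact thermal scaling identity (`(q, p) ↦ √T·(q, p)` maps the `(lam, T)`-chain onto the `(lam·T, 1)`-chain, Gibbs data and
Langevin baths included) … state the identity for the objects door v9 actually uses (`escapeDeficit`, `crossKernel`/`escapeKernel`,
`survival`), prove it sorry-free over tree imports only".  Honest tag: **ATTACKABLE · TRUE · NORMAL-FORM** — an equal-strength
re-parametrisation of the escape currency; it is NOT a split of 11071, earns no rung of the ladder and is not an EQUIV node.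

## The identity

The amplitude scaling `S_c(q, p) = (c q, c p)` (`c > 0`) conjugates the Langevin-driven pinned chain
`pinnedChain ω₂ lam β γ` (`U = ω₂q²/2 + lam q⁴/4`, `V = r²/2 + β r⁴/4`, friction `γ`) at bath temperatures `(c²T_L, c²T_R)` to the
chain `pinnedChain ω₂ (lam·c²) (β·c²) γ` at `(T_L, T_R)`: `H_{lam,β}(S_c x) = c²·H_{lam c²,β c²}(x)` (the barrier file's
`hamiltonian_smul`, Aoki–Lukkarinen–Spohn (2.8)–(2.10) without the time rescaling, so `ω₂` and `γ` are fixed), the drift is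
`c`-equivariant (`drift_smul`: `U'`, `V'` are odd cubic polynomials whose cubic coefficient absorbs `c²`), the boundary noise
`√(2γ·c²T) dB = c·√(2γT) dB` is linear, hence PATHWISE `Φ^{lam,β;c²T}_t(S_c x, B) = S_c Φ^{lam c²,β c²;T}_t(x, B)` for every pair
of driving paths (`solMap_smul`, from the tree's uniqueness theorem `pinnedChain_eqOn_chainFlow`), so the constructed transition
kernel and the Gibbs measure transform by push-forward (`transitionKernel_smul`, `integral_gibbsMeasure_smul`).  Consequently, with
`θ₀ = p₀² − T` of weight `c²`:

* `K_N`, `K×_N` (escape / cross kernels) scale by `c⁴` at fixed time: `escapeKernel_smul`, `crossKernel_smul`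
  (the finite-chain, Langevin-bath form of the current-covariance scaling ALS (2.11) at `α = 1`, i.e. WITHOUT time rescaling);
* the prefactor `γ/T²` absorbs exactly `c⁴`, so `E_N`, `θ_N(s)`, `W_N(t)`, `Ov_N(t)` and the two-exit survival function `S_N(t)`
  are INVARIANT: `escapeDeficit_smul`, `stepResponse_smul`, `deficitCesaro_smul`, `escapeTransient_smul`, `survival_smul`;
* energies have weight two as well (`hamiltonian_smul`), so the storage kernel `g_N`, `Var_T(H_N)` and the energy–corrector pairing
  scale by `c⁴` (`storageKernel_smul`, `energyVariance_smul`, `energyPairing_smul`) and the storage / leak functionals of 95E are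
  INVARIANT (`storageResponse_smul`, `leakResponse_smul`): EVERY object in which the pieces of door v9 and of the sign / floor
  ladders (`TailSign`) are typed transforms by an explicit power of `c`;
* normal form (`c = √T`): `E_N(lam, β; T) = E_N(T·lam, T·β; 1)` (`escapeDeficit_eq_unitTemperature`), likewise `S_N`, and
  `K_N(lam,β;T) = T²·K_N(T lam, T β; 1)`; the escape currency depends on `(lam, β, T)` only through the RAY `(T·lam, T·β)`
  (`escapeDeficit_eq_of_ray`).

## What it buys (bookkeeping, not a rung)

* `OhmicFloor` (11071) ⟺ its `T = 1` slice over all couplings (`ohmicFloor_iff_unitTemperature`; so is `BoundedResponse`,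
  `boundedResponse_iff_unitTemperature`): every floor / window / tail statement of door v9 may be proved at `T = 1` only.
* "uniform in `T ∈ (0, T₀]` at fixed `(lam, β)`" ≡ "uniform along the coupling ray `{(s·lam, s·β) : 0 < s ≤ T₀}` at `T = 1`":
  the LOW-TEMPERATURE axis of the census IS the WEAK-ANHARMONICITY axis (`Literature.Barriers.AtomisticToContinuum.
  LowTemperatureWeakAnharmonicity`, there proved at the generator / steady-state level: `generator_smul`,
  `isSteadyState_map_smul`; HERE pushed to the SDE flow, the transition kernel, the Gibbs measure and the escape currency —
  item (a) of the docstring of `EscapeGrading.LowTemperatureContinuity`).  In particular the limit value in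
  `LowTemperatureContinuity` is the `s → 0⁺` endpoint of the ray, `E_N(0, 0; 1)` (harmonic chain) — literally:
  `lowTemperatureContinuity_iff_ray`, and `UniformOhmicFloor` is an ohmic floor uniform on the initial ray segment
  (`uniformOhmicFloor_iff_ray`, a uniform weak-anharmonicity statement — the tree's negative target) — and the 13198-type witness
  families at `lam·T = const` are single points of the normal form.
* No hypothesis on the sign of `T` is needed for the algebraic identities; the kernel identities use the tree's standing
  hypotheses `0 < ω₂`, `0 ≤ lam`, `0 ≤ β`, `0 ≤ γ` (existence/uniqueness of the flow, `pinnedChain_transitionKernel_apply`).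

Presearch: thermal/amplitude scaling of the anharmonic pinned chain → [corpus:paper:arxiv-cond-mat_0602082 p.3, eqs. (2.8)–(2.13)]
(ALS 2006: `κ(T,ω₀,δ,λ) = α⁻¹κ(α²γ²T, αω₀, δ, α²γ⁻²λ)`, scaling form `κ = ω₀ Ξ(ω₀⁻⁴λT, δ)`), [galaxy:pdf:-1225612559323412660] (same
paper); tree: `Literature/Barriers/AtomisticToContinuum/LowTemperatureWeakAnharmonicity.lean` (`hamiltonian_smul`, `generator_smul`,
`isSteadyState_map_smul`, BLR 2000 eq. (10)).  Nothing in print or in the tree states the identity for the transition kernel /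
Green–Kubo escape objects of the finite Langevin chain; it is folklore-level and proved here in ≈ 40 lines per layer.

Imports: the tree modules `…BoundedResponseTailSign` (97T; all escape objects) and the barrier module (its `hamiltonian_smul`);
`HarnessLib`.  No `instance`, no `notation`, no `sorry`.
-/

noncomputable section

open MeasureTheory ProbabilityTheory Filter Topology Set Function
open scoped NNReal ENNReal
open Literature.MathematicalPhysics.KineticTheory.HeatConduction
open Literature.MathematicalPhysics.KineticTheory OscillatorChain
open Summit.AtomisticToContinuum.FouriersLaw.Theorems.SubdiffusiveBondHeat
open Summit.AtomisticToContinuum.FouriersLaw.Theorems.BoundedResponse.TransientBand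
open Literature.Barriers.AtomisticToContinuum.HeatConduction (hamiltonian_smul)

namespace Summit.AtomisticToContinuum.FouriersLaw.Theorems.BoundedResponse.ParityFloor

open Summit.AtomisticToContinuum.FouriersLaw.Theses.BondHeatUncertainty (BoundedResponse)
open Summit.AtomisticToContinuum.FouriersLaw.Theorems.SubdiffusiveBondHeat.EscapeGrading
open Literature.Probability.Process (WienerPair pairPath wienerPair)
open Literature.Analysis.ODE (IsIntegralSolutionOn)

section ThermalScaling

variable {N : ℕ}

/-! ## §1 Algebra: forces, Gibbs weight, contact observable -/

/-- **Force scaling.** `∂Φ_{lam,β}/∂q_i (c·q) = c · ∂Φ_{lam c²,β c²}/∂q_i (q)`: `U'(q) = ω₂q + lam q³` and `V'(r) = r + βr³` are odd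
with the cubic coefficient absorbing `c²` (closed form `dPotential_eq_closed`). [folklore] -/
theorem dPotential_smul (ω₂ lam β γ c : ℝ) (N : ℕ) (i : Fin N) (q : Fin N → ℝ) :
    (pinnedChain ω₂ lam β γ).dPotential N i (c • q) =
      c * (pinnedChain ω₂ (lam * c ^ 2) (β * c ^ 2) γ).dPotential N i q := by
  rw [OscillatorChain.dPotential_eq_closed, OscillatorChain.dPotential_eq_closed]
  simp only [pinnedChain_deriv_U, pinnedChain_deriv_V, Pi.smul_apply, smul_eq_mul]
  split_ifs <;> ring

/-- **Drift equivariance.** The Langevin drift `Y(q,p) = (p, −∇Φ(q) − γ·1_{∂}·p)` satisfies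
`Y_{lam,β}(c·x) = c · Y_{lam c², β c²}(x)` (friction is linear, forces by `dPotential_smul`). [folklore] -/
theorem drift_smul (ω₂ lam β γ c : ℝ) (N : ℕ) (x : PhaseSpace N) :
    (pinnedChain ω₂ lam β γ).drift N (c • x) =
      c • (pinnedChain ω₂ (lam * c ^ 2) (β * c ^ 2) γ).drift N x := by
  have hd : ∀ l b : ℝ, (pinnedChain ω₂ l b γ).drift N = fun x =>
      (x.2, fun i => -(pinnedChain ω₂ l b γ).dPotential N i x.1 - γ * bathWeight N i * x.2 i) :=
    fun l b => (pinnedChain ω₂ l b γ).drift_eq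
      ((pinnedChain_contDiff_U ω₂ l b γ (n := 1)).differentiable one_ne_zero)
      ((pinnedChain_contDiff_V ω₂ l b γ (n := 1)).differentiable one_ne_zero) N
  rw [hd, hd]
  refine Prod.ext (by simp) (funext fun i => ?_)
  simp only [Prod.smul_fst, Prod.smul_snd, Prod.smul_mk, Pi.smul_apply, smul_eq_mul, dPotential_smul]
  ring

/-- **Gibbs weight.** `e^{−H_{lam,β}(c·x)/(c²T)} = e^{−H_{lam c²,β c²}(x)/T}` (`c ≠ 0`; energy scaling `hamiltonian_smul` of the
barrier file `LowTemperatureWeakAnharmonicity`). [folklore] -/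
theorem gibbsDensity_smul (ω₂ lam β γ : ℝ) {c : ℝ} (hc : c ≠ 0) (N : ℕ) (T : ℝ) (x : PhaseSpace N) :
    (pinnedChain ω₂ lam β γ).gibbsDensity N (c ^ 2 * T) (c • x) =
      (pinnedChain ω₂ (lam * c ^ 2) (β * c ^ 2) γ).gibbsDensity N T x := by
  simp only [OscillatorChain.gibbsDensity, hamiltonian_smul]
  rw [neg_div, neg_div, mul_div_mul_left _ _ (pow_ne_zero 2 hc)]

/-- The contact observable has weight two: `θ_b^{c²T}(c·y) = c²·θ_b^{T}(y)`. [folklore] -/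
theorem kinObs_smul (c T : ℝ) (N : ℕ) (b : Fin N) (y : PhaseSpace N) :
    kinObs (c ^ 2 * T) N b (c • y) = c ^ 2 * kinObs T N b y := by
  simp only [kinObs, Prod.smul_snd, Pi.smul_apply, smul_eq_mul]
  ring

/-! ## §2 Pathwise: noise, forcing, the SDE flow and the solution map -/

/-- The boundary noise is linear in its amplitudes: `ξ^{c a, c b}(w) = c · ξ^{a,b}(w)` for every pair of raw paths. [folklore] -/
private theorem chainNoise_smul (c a b : ℝ) (w : WienerPair) :
    chainNoise N (c * a) (c * b) w = c • chainNoise N a b w := by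
  funext t i
  simp only [chainNoise, Pi.smul_apply, smul_eq_mul]
  split_ifs <;> ring

/-- The forcing path of the integral equation is linear: `g_{c x, c η} = c · g_{x,η}`. [folklore] -/
theorem forcing_smul (c : ℝ) (x : PhaseSpace N) (η : ℝ → Fin N → ℝ) (t : ℝ) :
    forcing (c • x) (c • η) t = c • forcing x η t := by
  simp only [forcing, smul_add, Prod.smul_mk, smul_zero, Pi.smul_apply]

/-- **Flow equivariance.** For a continuous driving path `η`, the global solution of the Langevin integral equation satisfies
`Φ^{lam,β}_t(c·x; c·η) = c · Φ^{lam c²,β c²}_t(x; η)` for all `t` (for `t ≤ 0` both sides are the clamped initial values; for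
`t ≥ 0` the right-hand side solves the left-hand equation by `drift_smul`, and the tree's uniqueness theorem
`pinnedChain_eqOn_chainFlow` identifies it). [folklore] -/
theorem chainFlow_smul {ω₂ lam β γ : ℝ} (hω : 0 < ω₂) (hl : 0 ≤ lam) (hβ : 0 ≤ β) (hγ : 0 ≤ γ)
    (c : ℝ) (N : ℕ) (x : PhaseSpace N) {η : ℝ → Fin N → ℝ} (hη : Continuous η) (t : ℝ) :
    (pinnedChain ω₂ lam β γ).chainFlow N (c • x) (c • η) t =
      c • (pinnedChain ω₂ (lam * c ^ 2) (β * c ^ 2) γ).chainFlow N x η t := by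
  have hηc : Continuous (c • η) := hη.const_smul c
  rcases le_or_gt t 0 with ht | ht
  · rw [pinnedChain_chainFlow_of_nonpos ω₂ lam β γ N (c • x) hηc ht,
      pinnedChain_chainFlow_of_nonpos ω₂ (lam * c ^ 2) (β * c ^ 2) γ N x hη ht]
    simp only [smul_add, Prod.smul_mk, smul_zero, Pi.smul_apply]
  · have hl' : 0 ≤ lam * c ^ 2 := mul_nonneg hl (sq_nonneg c)
    have hβ' : 0 ≤ β * c ^ 2 := mul_nonneg hβ (sq_nonneg c)
    have hsol := pinnedChain_isIntegralSolutionOn_chainFlow hω hl' hβ' hγ N x hη t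
    have hz : IsIntegralSolutionOn ((pinnedChain ω₂ lam β γ).drift N) (forcing (c • x) (c • η))
        (fun s => c • (pinnedChain ω₂ (lam * c ^ 2) (β * c ^ 2) γ).chainFlow N x η s) t := by
      intro s hs
      have h1 := hsol s hs
      simp only [drift_smul]
      rw [intervalIntegral.integral_smul, forcing_smul, ← smul_add, ← h1]
    have hzc : Continuous fun s => c • (pinnedChain ω₂ (lam * c ^ 2) (β * c ^ 2) γ).chainFlow N x η s :=
      (pinnedChain_continuous_chainFlow hω hl' hβ' hγ N x hη).const_smul c
    have heq := pinnedChain_eqOn_chainFlow hω hl hβ hγ N (c • x) hηc hz hzc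
    exact (heq ⟨ht.le, le_rfl⟩).symm

/-- **Solution-map equivariance** (`c ≥ 0`): with bath temperatures multiplied by `c²` the noise amplitudes
`√(2γ·c²T) = c·√(2γT)` scale linearly, so `Φ^{lam,β; c²T_L, c²T_R}_t(c·x, w) = c · Φ^{lam c²,β c²; T_L,T_R}_t(x, w)` for EVERY pair
of raw driving paths `w`. [folklore] -/
theorem solMap_smul {ω₂ lam β γ : ℝ} (hω : 0 < ω₂) (hl : 0 ≤ lam) (hβ : 0 ≤ β) (hγ : 0 ≤ γ)
    {c : ℝ} (hc : 0 ≤ c) (N : ℕ) (T_L T_R t : ℝ) (x : PhaseSpace N) (w : WienerPair) :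
    (pinnedChain ω₂ lam β γ).solMap N (c ^ 2 * T_L) (c ^ 2 * T_R) t (c • x) w =
      c • (pinnedChain ω₂ (lam * c ^ 2) (β * c ^ 2) γ).solMap N T_L T_R t x w := by
  have hsq : ∀ T : ℝ, Real.sqrt (2 * γ * (c ^ 2 * T)) = c * Real.sqrt (2 * γ * T) := fun T => by
    rw [show 2 * γ * (c ^ 2 * T) = c ^ 2 * (2 * γ * T) by ring, Real.sqrt_mul (sq_nonneg c), Real.sqrt_sq hc]
  unfold OscillatorChain.solMap
  rw [show (pinnedChain ω₂ lam β γ).γ = γ from rfl,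
    show (pinnedChain ω₂ (lam * c ^ 2) (β * c ^ 2) γ).γ = γ from rfl, hsq, hsq, chainNoise_smul]
  exact chainFlow_smul hω hl hβ hγ c N x (continuous_chainNoise _ _ w) t

/-! ## §3 Laws: the transition kernel and the Gibbs measure transform by push-forward -/

/-- **Kernel covariance.** `P^{lam,β; c²T_L,c²T_R}_t(c·x, ·) = (S_c)_* P^{lam c²,β c²; T_L,T_R}_t(x, ·)` for the constructed
transition kernel (`pinnedChain_transitionKernel_apply` on both sides and `solMap_smul` under the Wiener pair). [folklore] -/
theorem transitionKernel_smul {ω₂ lam β γ : ℝ} (hω : 0 < ω₂) (hl : 0 ≤ lam) (hβ : 0 ≤ β) (hγ : 0 ≤ γ)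
    {c : ℝ} (hc : 0 ≤ c) (N : ℕ) (T_L T_R : ℝ) (t : ℝ≥0) (x : PhaseSpace N) :
    (pinnedChain ω₂ lam β γ).transitionKernel N (c ^ 2 * T_L) (c ^ 2 * T_R) t (c • x) =
      ((pinnedChain ω₂ (lam * c ^ 2) (β * c ^ 2) γ).transitionKernel N T_L T_R t x).map (fun y => c • y) := by
  have hl' : 0 ≤ lam * c ^ 2 := mul_nonneg hl (sq_nonneg c)
  have hβ' : 0 ≤ β * c ^ 2 := mul_nonneg hβ (sq_nonneg c)
  rw [pinnedChain_transitionKernel_apply hω hl hβ hγ, pinnedChain_transitionKernel_apply hω hl' hβ' hγ,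
    Measure.map_map (measurable_const_smul c)
      (pinnedChain_measurable_solMap_pairPath_right hω hl' hβ' hγ N T_L T_R t x)]
  congr 1
  funext ω
  exact solMap_smul hω hl hβ hγ hc N T_L T_R t x (pairPath ω)

/-- Integrals against the kernel: `∫ g dP^{lam,β;c²T_L,c²T_R}_t(c·x, ·) = ∫ g(c·y) P^{lam c²,β c²;T_L,T_R}_t(x, dy)` (`c > 0`, so
that `S_c` is a measurable equivalence and no measurability of `g` is needed). [folklore] -/
theorem integral_transitionKernel_smul {ω₂ lam β γ : ℝ} (hω : 0 < ω₂) (hl : 0 ≤ lam) (hβ : 0 ≤ β) (hγ : 0 ≤ γ)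
    {c : ℝ} (hc : 0 < c) (N : ℕ) (T_L T_R : ℝ) (t : ℝ≥0) (x : PhaseSpace N) (g : PhaseSpace N → ℝ) :
    ∫ y, g y ∂((pinnedChain ω₂ lam β γ).transitionKernel N (c ^ 2 * T_L) (c ^ 2 * T_R) t (c • x)) =
      ∫ y, g (c • y) ∂((pinnedChain ω₂ (lam * c ^ 2) (β * c ^ 2) γ).transitionKernel N T_L T_R t x) := by
  rw [transitionKernel_smul hω hl hβ hγ hc.le]
  exact integral_map_equiv (MeasurableEquiv.smul₀ c hc.ne') g

/-- **Gibbs covariance.** `∫ g dμ^{lam,β}_{c²T} = ∫ g(c·y) μ^{lam c²,β c²}_T(dy)` (`c ≠ 0`): both sides are the normalised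
Lebesgue integrals of `integral_gibbsMeasure`; substituting `x = c·y` (`Measure.integral_comp_smul`, Lebesgue measure on phase
space is an additive Haar measure) multiplies numerator and denominator by the same Jacobian `|c|^{−2N}`, and the weights agree by
`gibbsDensity_smul`.  No sign or integrability hypothesis (junk values match). [folklore] -/
theorem integral_gibbsMeasure_smul (ω₂ lam β γ : ℝ) {c : ℝ} (hc : c ≠ 0) (N : ℕ) (T : ℝ) (g : PhaseSpace N → ℝ) :
    ∫ x, g x ∂((pinnedChain ω₂ lam β γ).gibbsMeasure N (c ^ 2 * T)) =
      ∫ y, g (c • y) ∂((pinnedChain ω₂ (lam * c ^ 2) (β * c ^ 2) γ).gibbsMeasure N T) := by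
  haveI := isAddHaarMeasure_volume_phaseSpace N
  have ha0 : |(c ^ Module.finrank ℝ (PhaseSpace N))⁻¹| ≠ 0 :=
    abs_ne_zero.2 (inv_ne_zero (pow_ne_zero _ hc))
  rw [OscillatorChain.integral_gibbsMeasure, OscillatorChain.integral_gibbsMeasure]
  have h1 : ∫ y, (pinnedChain ω₂ (lam * c ^ 2) (β * c ^ 2) γ).gibbsDensity N T y =
      |(c ^ Module.finrank ℝ (PhaseSpace N))⁻¹| * ∫ x, (pinnedChain ω₂ lam β γ).gibbsDensity N (c ^ 2 * T) x := by
    have h := Measure.integral_comp_smul volume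
      (fun x => (pinnedChain ω₂ lam β γ).gibbsDensity N (c ^ 2 * T) x) c
    simp only [gibbsDensity_smul ω₂ lam β γ hc, smul_eq_mul] at h
    rw [h]
  have h2 : ∫ y, g (c • y) * (pinnedChain ω₂ (lam * c ^ 2) (β * c ^ 2) γ).gibbsDensity N T y =
      |(c ^ Module.finrank ℝ (PhaseSpace N))⁻¹| *
        ∫ x, g x * (pinnedChain ω₂ lam β γ).gibbsDensity N (c ^ 2 * T) x := by
    have h := Measure.integral_comp_smul volume
      (fun x => g x * (pinnedChain ω₂ lam β γ).gibbsDensity N (c ^ 2 * T) x) c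
    simp only [gibbsDensity_smul ω₂ lam β γ hc, smul_eq_mul] at h
    rw [h]
  rw [h1, h2, mul_inv, mul_mul_mul_comm, inv_mul_cancel₀ ha0, one_mul]

end ThermalScaling

end Summit.AtomisticToContinuum.FouriersLaw.Theorems.BoundedResponse.ParityFloor
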